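import Summits.NavierStokesRegularity.NavierStokesRegularity.Theorems.AdaptedFrequencyAdaptedFrequencyConvergesStubDoeblinAdjoint
import Summits.NavierStokesRegularity.NavierStokesRegularity.Theorems.AdaptedFrequencyAdaptedFrequencyConvergesStubDoeblinBridge

/-!
# Crux `AdaptedFrequencyConverges` (stmt-NavierStokesRegularity-10493), line
  `cloud-frame-effective-tsai`: limits at the top of a block and evolution of block data,
  for STUB `stub_doeblin`

Helper file (theorems only; lands `--supports stmt-NavierStokesRegularity-10493`) for the
registered stub `stub_doeblin`. The block solver of the line (a hypothesis of the stub) produces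
classical solutions on the half-open block `[σ, σ') × ℝ³` attaining their terminal data only in
the limit `τ ↑ σ'`, while Kato's monotonicity and the minorisation are stated on closed blocks
`[σ, σ₃]`, `σ₃ < σ'`. This file passes to the limit `σ₃ ↑ σ'` and packages the evolved data:

* `doeblin_kato_limit` — for a jointly `C²` solution `E` of the adjoint equation on `[σ, σ')`
  with a Gaussian envelope and pointwise limits `E(τ, x) → g(x)` as `τ ↑ σ'`:
  `∫ |E(σ)| ≤ ∫ |g|` (Kato on `[σ, σ₃]`, dominated convergence);
* `doeblin_tendsto_of_attain`, `doeblin_tendsto_kernel` — the pointwise limits for block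
  solutions (uniform attainment) and for kernels (joint continuity);
* `doeblin_minor_limit` — the Gaussian lower bound `doeblin_block_lower` at the bottom of
  `[σ, σ₃]` by a weight below `W(σ₃, ·)` for all `σ₃` near `σ'`, in the limit `σ₃ ↑ σ'`;
* `doeblin_core_lower`, `doeblin_evolve` — on a dyadic block `[σ, σ']`, `T − σ = 2(T − σ') = 2ℓ`,
  of a smooth divergence-free Type-I drift `‖b‖ ≤ C/√(T − t)` on `S ⊇ [s₀, σ' + ℓ/2]`, `s₀ < σ`,
  the block solver evolves smooth compactly supported nonnegative data `f` backwards from `σ'`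
  into `W ≥ 0`: a jointly `C²` solution of the adjoint equation on `[σ, σ')` with a Gaussian
  envelope and pointwise limits `W(τ, ·) → f`, with `∫ W(σ) ≤ ∫ f` (Kato), bounded below on the
  core ball `B̄(x₀, R√ℓ)` at time `σ` by the core mass of the data times a BLOCK-INDEPENDENT
  constant, `(∫_{B̄(x₀,R√ℓ)} f) · kSubLow 3 (C/ν) (3R) ν · ℓ^{-3/2} ≤ W(σ, x)` (the minorisation
  with the weight `ψ · (f − ε)⁺`, `ψ` a bump of the core inside `B̄(x₀, 2R√ℓ)`, and the scale
  invariance `doeblin_kSubLow_scale`).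
-/

noncomputable section

namespace Summit.NavierStokesRegularity.NavierStokesRegularity.Theorems.AdaptedFrequencyConverges.CloudFrameEffectiveTsai

open scoped Topology Laplacian
open Literature.Analysis.FluidPDE Set Filter MeasureTheory Function Metric

/-! ### Limits at the top of a half-open block -/

/-- **Kato in the limit at the top of a half-open block.** Let `E` be a jointly `C²` solution of
`∂ₜE + b·∇E + νΔE = 0` on `[σ, σ') × ℝ³` (`[σ, σ') ⊆ S ⊆ (−∞, T)`, `b` a smooth divergence-free
Type-I drift on `S`) with a Gaussian envelope, and suppose `E(τ, x) → g(x)` for every `x` as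
`τ ↑ σ'`. Then `∫ |E(σ)| ≤ ∫ |g|` (given the Kato hypothesis of `stub_doeblin`). -/
theorem doeblin_kato_limit
    (hKato : ∀ (ν B s s' A a : ℝ)
      (b : ℝ → EuclideanSpace ℝ (Fin 3) → EuclideanSpace ℝ (Fin 3))
      (W : ℝ → EuclideanSpace ℝ (Fin 3) → ℝ), 0 < ν → s < s' → 0 < a →
      IsSmoothSpaceTimeOn (Icc s s') b → (∀ τ ∈ Icc s s', VectorCalculus.IsDivFree (b τ)) →
      (∀ τ ∈ Icc s s', ∀ x, ‖b τ x‖ ≤ B) → ContDiffOn ℝ 2 (uncurry W) (Icc s s' ×ˢ univ) →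
      (∀ τ ∈ Icc s s', ∀ x, timeDerivWithin (Icc s s') W τ x + fderiv ℝ (W τ) x (b τ x) +
        ν * Laplacian.laplacian (W τ) x = 0) →
      (∀ τ ∈ Icc s s', ∀ x, |W τ x| ≤ A * Real.exp (-‖x‖ ^ 2 / a)) →
      ∫ x, |W s x| ≤ ∫ x, |W s' x|)
    {ν C T : ℝ} {S : Set ℝ} {b : ℝ → EuclideanSpace ℝ (Fin 3) → EuclideanSpace ℝ (Fin 3)}
    (hν : 0 < ν) (hST : S ⊆ Iio T) (hb : IsSmoothSpaceTimeOn S b)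
    (hdiv : ∀ t ∈ S, VectorCalculus.IsDivFree (b t))
    (hbd : ∀ t ∈ S, ∀ x, ‖b t x‖ ≤ C / Real.sqrt (T - t)) {σ σ' : ℝ} (hσσ' : σ < σ')
    (hI : Ico σ σ' ⊆ S) {E : ℝ → EuclideanSpace ℝ (Fin 3) → ℝ}
    (hc : ContDiffOn ℝ 2 (uncurry E) (Ico σ σ' ×ˢ univ))
    (he : ∀ τ ∈ Ico σ σ', ∀ x, timeDerivWithin (Ico σ σ') E τ x + fderiv ℝ (E τ) x (b τ x) +
      ν * (Δ (E τ)) x = 0)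
    (henv : ∃ A a : ℝ, 0 < a ∧ ∀ τ ∈ Ico σ σ', ∀ x, |E τ x| ≤ A * Real.exp (-‖x‖ ^ 2 / a))
    {g : EuclideanSpace ℝ (Fin 3) → ℝ}
    (hlim : ∀ x, Tendsto (fun τ => E τ x) (𝓝[<] σ') (𝓝 (g x))) :
    ∫ x, |E σ x| ≤ ∫ x, |g x| := by
  -- Kato on every closed sub-block
  have hmono : ∀ σ₃ ∈ Ioo σ σ', ∫ x, |E σ x| ≤ ∫ x, |E σ₃ x| := by
    intro σ₃ hσ₃
    have hsub : Icc σ σ₃ ⊆ Ico σ σ' := fun τ hτ => ⟨hτ.1, hτ.2.trans_lt hσ₃.2⟩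
    have hr := doeblin_adj_mono hsub (uniqueDiffOn_Icc hσ₃.1) hc he
    exact doeblin_kato hKato hν hST hb hdiv hbd hσ₃.1 (hsub.trans hI) hr.1 hr.2
      (doeblin_envelope_mono hsub henv)
  -- dominated convergence
  obtain ⟨A, a, ha, hAe⟩ := henv
  have hT : Tendsto (fun σ₃ => ∫ x, |E σ₃ x|) (𝓝[<] σ') (𝓝 (∫ x, |g x|)) := by
    refine tendsto_integral_filter_of_dominated_convergence
      (fun x => A * Real.exp (-‖x‖ ^ 2 / a)) ?_ ?_ ((doeblin_integrable_gauss ha).const_mul A) ?_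
    · filter_upwards [Ioo_mem_nhdsLT hσσ'] with σ₃ hσ₃
      exact (doeblin_contDiff_slice hc
        (Ioo_subset_Ico_self hσ₃)).continuous.abs.aestronglyMeasurable
    · filter_upwards [Ioo_mem_nhdsLT hσσ'] with σ₃ hσ₃
      exact Eventually.of_forall fun x => by
        rw [Real.norm_eq_abs, abs_abs]; exact hAe σ₃ (Ioo_subset_Ico_self hσ₃) x
    · exact Eventually.of_forall fun x => (hlim x).abs
  exact ge_of_tendsto hT (by
    filter_upwards [Ioo_mem_nhdsLT hσσ'] with σ₃ hσ₃ using hmono σ₃ hσ₃)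

/-- Uniform attainment of the terminal data `f` as `τ ↑ σ'` gives the pointwise limits
`W(τ, x) → f(x)`. -/
theorem doeblin_tendsto_of_attain {W : ℝ → EuclideanSpace ℝ (Fin 3) → ℝ}
    {f : EuclideanSpace ℝ (Fin 3) → ℝ} {s σ' : ℝ}
    (hatt : ∀ ε : ℝ, 0 < ε → ∃ s₂ ∈ Ico s σ', ∀ τ ∈ Ico s₂ σ', ∀ x, |W τ x - f x| ≤ ε)
    (x : EuclideanSpace ℝ (Fin 3)) : Tendsto (fun τ => W τ x) (𝓝[<] σ') (𝓝 (f x)) := by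
  rw [Metric.tendsto_nhds]
  intro ε hε
  obtain ⟨s₂, hs₂, h⟩ := hatt (ε / 2) (half_pos hε)
  filter_upwards [Ico_mem_nhdsLT hs₂.2] with τ hτ
  rw [Real.dist_eq]
  exact (h τ hτ x).trans_lt (half_lt_self hε)

/-- The time lines of a jointly `C²` kernel on `S ⊇ [σ, σ']` tend to their value at `σ'` as
`τ ↑ σ'`. -/
theorem doeblin_tendsto_kernel {K : ℝ → EuclideanSpace ℝ (Fin 3) → ℝ} {S : Set ℝ}
    (hc : ContDiffOn ℝ 2 (uncurry K) (S ×ˢ univ)) {σ σ' : ℝ} (hσσ' : σ < σ') (hI : Icc σ σ' ⊆ S)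
    (x : EuclideanSpace ℝ (Fin 3)) : Tendsto (fun τ => K τ x) (𝓝[<] σ') (𝓝 (K σ' x)) := by
  have h1 : ContinuousWithinAt (fun τ => K τ x) S σ' :=
    doeblin_continuousWithinAt_time hc (hI (right_mem_Icc.2 hσσ'.le)) x
  have h2 : 𝓝[<] σ' ≤ 𝓝[S] σ' := by
    rw [← nhdsWithin_Ioo_eq_nhdsLT hσσ']
    exact nhdsWithin_mono _ (fun τ hτ => hI ⟨hτ.1.le, hτ.2.le⟩)
  exact h1.tendsto.mono_left h2

/-- **Minorisation in the limit at the top of a half-open block.** Let `W ≥ 0` be a jointly `C²`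
solution of the adjoint equation on `[σ⋆, σ') × ℝ³`, `σ⋆ < σ < σ'`, with `‖b‖ ≤ B` on `[σ, σ')`
(`b` jointly smooth on `S ⊇ [σ, σ')`), and let the continuous weight `φ ≥ 0`, carried by
`B̄(x₀, r_s)`, lie below `W(σ₃, ·)` for all `σ₃ ∈ [s₂, σ')`. Then on `B̄(x₀, r_e)`:
`(∫ φ) · kSubLow 3 (B/ν) (r_e + r_s) (ν(σ' − σ)) ≤ W(σ, x)` (the bound `doeblin_block_lower` on
`[σ, σ₃]`, and `σ₃ ↑ σ'` by continuity of the profile in the age). -/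
theorem doeblin_minor_limit {ν σs σ σ' B rs re s₂ : ℝ} {S : Set ℝ}
    {b : ℝ → EuclideanSpace ℝ (Fin 3) → EuclideanSpace ℝ (Fin 3)}
    {W : ℝ → EuclideanSpace ℝ (Fin 3) → ℝ} {x₀ : EuclideanSpace ℝ (Fin 3)}
    {φ : EuclideanSpace ℝ (Fin 3) → ℝ} (hν : 0 < ν) (h₀ : σs < σ) (h₁ : σ < σ')
    (hb : IsSmoothSpaceTimeOn S b) (hSI : Ico σ σ' ⊆ S) (hB : ∀ s ∈ Ico σ σ', ∀ x, ‖b s x‖ ≤ B)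
    (hB0 : 0 ≤ B) (hWc : ContDiffOn ℝ 2 (uncurry W) (Ico σs σ' ×ˢ univ))
    (hWe : ∀ τ ∈ Ico σs σ', ∀ x, timeDerivWithin (Ico σs σ') W τ x + fderiv ℝ (W τ) x (b τ x) +
      ν * (Δ (W τ)) x = 0)
    (hW0 : ∀ τ ∈ Ico σs σ', ∀ x, 0 ≤ W τ x) (hφ : Continuous φ) (h0 : ∀ z, 0 ≤ φ z)
    (hrs : 0 < rs) (hsupp : tsupport φ ⊆ closedBall x₀ rs) (hs₂ : s₂ < σ')
    (hφW : ∀ σ₃ ∈ Ico s₂ σ', ∀ z, φ z ≤ W σ₃ z) :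
    ∀ x ∈ closedBall x₀ re,
      (∫ z, φ z) * kSubLow 3 (B / ν) (re + rs) (ν * (σ' - σ)) ≤ W σ x := by
  intro x hx
  have hIoo := doeblin_adj_mono Ioo_subset_Ico_self (uniqueDiffOn_Ioo σs σ') hWc hWe
  have hev : ∀ᶠ σ₃ in 𝓝[<] σ',
      (∫ z, φ z) * kSubLow 3 (B / ν) (re + rs) (ν * (σ₃ - σ)) ≤ W σ x := by
    filter_upwards [Ioo_mem_nhdsLT (max_lt h₁ hs₂)] with σ₃ hσ₃
    have hσσ₃ : σ < σ₃ := (le_max_left _ _).trans_lt hσ₃.1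
    have hs₂σ₃ : s₂ ≤ σ₃ := ((le_max_right _ _).trans_lt hσ₃.1).le
    exact doeblin_block_lower hν h₀ hσσ₃ hσ₃.2 hb (fun τ hτ => hSI ⟨hτ.1, hτ.2.trans_lt hσ₃.2⟩)
      (fun s hs y => hB s ⟨hs.1, hs.2.trans_lt hσ₃.2⟩ y) hB0 hIoo.1 hIoo.2
      (fun τ hτ y => hW0 τ (Ioo_subset_Ico_self hτ) y) hφ h0 (hφW σ₃ ⟨hs₂σ₃, hσ₃.2⟩) hrs hsupp
      x hx
  have hcont : Tendsto (fun σ₃ => (∫ z, φ z) * kSubLow 3 (B / ν) (re + rs) (ν * (σ₃ - σ)))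
      (𝓝[<] σ') (𝓝 ((∫ z, φ z) * kSubLow 3 (B / ν) (re + rs) (ν * (σ' - σ)))) := by
    have hk : ContinuousAt (fun σ₃ => kSubLow 3 (B / ν) (re + rs) (ν * (σ₃ - σ))) σ' := by
      refine ContinuousAt.comp (g := kSubLow 3 (B / ν) (re + rs)) (f := fun σ₃ : ℝ => ν * (σ₃ - σ))
        ?_ (by fun_prop)
      exact (continuousOn_kSubLow 3 (B / ν) (re + rs)).continuousAt
        (Ioi_mem_nhds (mul_pos hν (sub_pos.2 h₁)))
    exact (hk.tendsto.const_mul (∫ z, φ z)).mono_left nhdsWithin_le_nhds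
  exact le_of_tendsto hcont hev

/-! ### Evolution of block data -/

/-- On the half-open block `[σ, σ')` of a Type-I drift on `S ⊆ (−∞, T)`, `‖b‖ ≤ C/√(T − σ')`. -/
theorem doeblin_drift_bound_Ico {C T : ℝ} {S : Set ℝ}
    {b : ℝ → EuclideanSpace ℝ (Fin 3) → EuclideanSpace ℝ (Fin 3)} (hST : S ⊆ Iio T)
    (hbd : ∀ t ∈ S, ∀ x, ‖b t x‖ ≤ C / Real.sqrt (T - t)) {σ σ' : ℝ} (hI : Ico σ σ' ⊆ S)
    (hσσ' : σ < σ') (hσ'T : σ' < T) :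
    ∀ τ ∈ Ico σ σ', ∀ x, ‖b τ x‖ ≤ C / Real.sqrt (T - σ') := by
  intro τ hτ x
  have hC : 0 ≤ C := doeblin_C_nonneg (hST (hI ⟨le_rfl, hσσ'⟩)) (hbd σ (hI ⟨le_rfl, hσσ'⟩))
  refine (hbd τ (hI hτ) x).trans ?_
  exact div_le_div_of_nonneg_left hC (Real.sqrt_pos.2 (sub_pos.2 hσ'T))
    (Real.sqrt_le_sqrt (by linarith [hτ.2]))

/-- **Lower bound on the core by the core mass of the data.** Let `W ≥ 0` be a jointly `C²`
solution of the adjoint equation on `[σ⋆, σ') × ℝ³` attaining the continuous integrable data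
`f ≥ 0` uniformly as `τ ↑ σ'`, on a dyadic block `T − σ = 2(T − σ') = 2ℓ` of a Type-I drift on
`S ⊇ [σ, σ')`. Then for `x ∈ B̄(x₀, R√ℓ)`:
`(∫_{B̄(x₀, R√ℓ)} f) · (kSubLow 3 (C/ν) (3R) ν · ℓ^{-3/2}) ≤ W(σ, x)` — the weight
`ψ · (f − ε)⁺` (`ψ` a bump of `B̄(x₀, R√ℓ) ⊂ B̄(x₀, 2R√ℓ)`) lies below `W(σ₃, ·)` near `σ'` and has
mass `≥ ∫_{core} f − ε |core|`; `doeblin_minor_limit`, `doeblin_kSubLow_scale`, `ε → 0`. -/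
theorem doeblin_core_lower {ν C T σs σ σ' R : ℝ} {S : Set ℝ}
    {b : ℝ → EuclideanSpace ℝ (Fin 3) → EuclideanSpace ℝ (Fin 3)}
    {W : ℝ → EuclideanSpace ℝ (Fin 3) → ℝ} {x₀ : EuclideanSpace ℝ (Fin 3)}
    {f : EuclideanSpace ℝ (Fin 3) → ℝ} (hν : 0 < ν) (hST : S ⊆ Iio T) (hb : IsSmoothSpaceTimeOn S b)
    (hbd : ∀ t ∈ S, ∀ x, ‖b t x‖ ≤ C / Real.sqrt (T - t)) (h₀ : σs < σ) (hσσ' : σ < σ')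
    (hℓ : T - σ = 2 * (T - σ')) (hSI : Ico σ σ' ⊆ S) (hσ'T : σ' < T) (hR : 0 < R)
    (hWc : ContDiffOn ℝ 2 (uncurry W) (Ico σs σ' ×ˢ univ))
    (hWe : ∀ τ ∈ Ico σs σ', ∀ x, timeDerivWithin (Ico σs σ') W τ x + fderiv ℝ (W τ) x (b τ x) +
      ν * (Δ (W τ)) x = 0)
    (hW0 : ∀ τ ∈ Ico σs σ', ∀ x, 0 ≤ W τ x)
    (hatt : ∀ ε : ℝ, 0 < ε → ∃ s₂ ∈ Ico σs σ', ∀ τ ∈ Ico s₂ σ', ∀ x, |W τ x - f x| ≤ ε)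
    (hfc : Continuous f) (hfi : Integrable f) :
    ∀ x ∈ closedBall x₀ (R * Real.sqrt (T - σ')),
      (∫ z in closedBall x₀ (R * Real.sqrt (T - σ')), f z) *
        (kSubLow 3 (C / ν) (3 * R) ν * (T - σ') ^ (-(3:ℝ) / 2)) ≤ W σ x := by
  have hC : 0 ≤ C := doeblin_C_nonneg (hST (hSI ⟨le_rfl, hσσ'⟩)) (hbd σ (hSI ⟨le_rfl, hσσ'⟩))
  have hB := doeblin_drift_bound_Ico hST hbd hSI hσσ' hσ'T
  intro x hx
  set ℓ : ℝ := T - σ' with hℓdef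
  have hℓ0 : 0 < ℓ := sub_pos.2 hσ'T
  have hσ'σ : σ' - σ = ℓ := by rw [hℓdef]; linarith
  have hu : 0 < R * Real.sqrt ℓ := mul_pos hR (Real.sqrt_pos.2 hℓ0)
  have hB0 : 0 ≤ C / Real.sqrt ℓ := div_nonneg hC (Real.sqrt_nonneg _)
  -- notation: the profile and the core volume
  set k : ℝ := kSubLow 3 (C / Real.sqrt ℓ / ν) (R * Real.sqrt ℓ + 2 * (R * Real.sqrt ℓ)) (ν * ℓ)
    with hkdef
  have hk0 : 0 < k := kSubLow_pos _ _ _ (mul_pos hν hℓ0)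
  have hkscale : k = ℓ ^ (-(3:ℝ) / 2) * kSubLow 3 (C / ν) (3 * R) ν :=
    doeblin_kSubLow_scale C R hν hℓ0
  set v : ℝ := volume.real (closedBall x₀ (R * Real.sqrt ℓ)) with hvdef
  have hv0 : 0 ≤ v := measureReal_nonneg
  -- the bump of the core
  let ψ : ContDiffBump x₀ := ⟨R * Real.sqrt ℓ, 2 * (R * Real.sqrt ℓ), hu, by linarith⟩
  have hψs : tsupport (ψ : EuclideanSpace ℝ (Fin 3) → ℝ) = closedBall x₀ (2 * (R * Real.sqrt ℓ)) :=
    ψ.tsupport_eq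
  -- for every `ε > 0`
  have key : ∀ ε : ℝ, 0 < ε →
      ((∫ z in closedBall x₀ (R * Real.sqrt ℓ), f z) - ε * v) * k ≤ W σ x := by
    intro ε hε
    obtain ⟨s₂, hs₂, hatt'⟩ := hatt ε hε
    obtain ⟨h, hh⟩ : ∃ h : EuclideanSpace ℝ (Fin 3) → ℝ, h = fun z => ψ z * max (f z - ε) 0 :=
      ⟨_, rfl⟩
    have hhc : Continuous h := by
      rw [hh]; exact ψ.continuous.mul ((hfc.sub continuous_const).max continuous_const)
    have hh0 : ∀ z, 0 ≤ h z := fun z => by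
      rw [hh]; exact mul_nonneg ψ.nonneg (le_max_right _ _)
    have hhsupp : tsupport h ⊆ closedBall x₀ (2 * (R * Real.sqrt ℓ)) := by
      rw [← hψs, hh]; exact tsupport_mul_subset_left
    have hhW : ∀ σ₃ ∈ Ico s₂ σ', ∀ z, h z ≤ W σ₃ z := by
      intro σ₃ hσ₃ z
      have h1 : max (f z - ε) 0 ≤ W σ₃ z := by
        refine max_le ?_ (hW0 σ₃ ⟨hs₂.1.trans hσ₃.1, hσ₃.2⟩ z)
        have := hatt' σ₃ hσ₃ z
        rw [abs_le] at this
        linarith [this.1]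
      rw [hh]
      calc ψ z * max (f z - ε) 0 ≤ 1 * max (f z - ε) 0 :=
            mul_le_mul_of_nonneg_right ψ.le_one (le_max_right _ _)
        _ = max (f z - ε) 0 := one_mul _
        _ ≤ W σ₃ z := h1
    have hmin := doeblin_minor_limit (re := R * Real.sqrt ℓ) hν h₀ hσσ' hb hSI hB hB0 hWc hWe hW0
      hhc hh0 (by positivity) hhsupp hs₂.2 hhW x hx
    rw [hσ'σ] at hmin
    -- the mass of the weight
    have hhi : Integrable h := hhc.integrable_of_hasCompactSupport
      ((isCompact_closedBall x₀ _).of_isClosed_subset (isClosed_tsupport h) hhsupp)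
    have hm1 : ∫ z in closedBall x₀ (R * Real.sqrt ℓ), h z ≤ ∫ z, h z :=
      setIntegral_le_integral hhi (Eventually.of_forall hh0)
    have hm2 : ∫ z in closedBall x₀ (R * Real.sqrt ℓ), h z =
        ∫ z in closedBall x₀ (R * Real.sqrt ℓ), max (f z - ε) 0 :=
      setIntegral_congr_fun measurableSet_closedBall fun z hz => by
        rw [hh]
        simp only [ψ.one_of_mem_closedBall hz, one_mul]
    have hfin : volume (closedBall x₀ (R * Real.sqrt ℓ)) ≠ ⊤ := measure_closedBall_lt_top.ne
    have hI1 : IntegrableOn (fun z => f z - ε) (closedBall x₀ (R * Real.sqrt ℓ)) :=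
      hfi.integrableOn.sub (integrableOn_const hfin)
    have hm3 : ∫ z in closedBall x₀ (R * Real.sqrt ℓ), (f z - ε) ≤
        ∫ z in closedBall x₀ (R * Real.sqrt ℓ), max (f z - ε) 0 :=
      setIntegral_mono_on hI1 hI1.pos_part measurableSet_closedBall fun z _ => le_max_left _ _
    have hm4 : ∫ z in closedBall x₀ (R * Real.sqrt ℓ), (f z - ε) =
        (∫ z in closedBall x₀ (R * Real.sqrt ℓ), f z) - ε * v := by
      rw [integral_sub hfi.integrableOn (integrableOn_const hfin), setIntegral_const, ← hvdef,
        smul_eq_mul]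
      ring
    have hmass : (∫ z in closedBall x₀ (R * Real.sqrt ℓ), f z) - ε * v ≤ ∫ z, h z := by
      rw [hm4, ← hm2] at hm3
      exact hm3.trans hm1
    calc ((∫ z in closedBall x₀ (R * Real.sqrt ℓ), f z) - ε * v) * k ≤ (∫ z, h z) * k :=
          mul_le_mul_of_nonneg_right hmass hk0.le
      _ ≤ W σ x := hmin
  -- `ε → 0`
  have hgoal : (∫ z in closedBall x₀ (R * Real.sqrt ℓ), f z) * k ≤ W σ x := by
    refine le_of_forall_pos_le_add fun ε' hε' => ?_
    have hvk : 0 ≤ v * k := mul_nonneg hv0 hk0.le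
    have hε : 0 < ε' / (v * k + 1) := div_pos hε' (by linarith)
    have h1 := key (ε' / (v * k + 1)) hε
    have h2 : ε' / (v * k + 1) * v * k ≤ ε' := by
      rw [mul_assoc, div_mul_eq_mul_div, div_le_iff₀ (by linarith)]
      nlinarith
    nlinarith
  calc (∫ z in closedBall x₀ (R * Real.sqrt ℓ), f z) *
        (kSubLow 3 (C / ν) (3 * R) ν * ℓ ^ (-(3:ℝ) / 2))
      = (∫ z in closedBall x₀ (R * Real.sqrt ℓ), f z) * k := by rw [hkscale, mul_comm (ℓ ^ _)]
    _ ≤ W σ x := hgoal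

/-- **Evolution of block data.** On a dyadic block `[σ, σ']`, `T − σ = 2(T − σ')`, `σ' < T`, with
room `[s₀, σ' + (T−σ')/2] ⊆ S`, `s₀ < σ`, of a smooth divergence-free Type-I drift on
`S ⊆ (−∞, T)`, the block solver (hypothesis of `stub_doeblin`) evolves `C^∞` compactly supported
data `f ≥ 0` backwards from `σ'` into `W ≥ 0`: a jointly `C²` solution of the adjoint equation on
`[σ, σ')` with a Gaussian envelope, `W(τ, ·) → f` pointwise as `τ ↑ σ'`, `W(σ)` integrable with
`∫ W(σ) ≤ ∫ f` (Kato, hypothesis of `stub_doeblin`, in the limit), and the block-independent lower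
bound `(∫_{B̄(x₀,R√ℓ)} f) · kSubLow 3 (C/ν) (3R) ν · ℓ^{-3/2} ≤ W(σ, ·)` on the core
`B̄(x₀, R√ℓ)`, `ℓ = T − σ'`. -/
theorem doeblin_evolve
    (hKato : ∀ (ν B s s' A a : ℝ)
      (b : ℝ → EuclideanSpace ℝ (Fin 3) → EuclideanSpace ℝ (Fin 3))
      (W : ℝ → EuclideanSpace ℝ (Fin 3) → ℝ), 0 < ν → s < s' → 0 < a →
      IsSmoothSpaceTimeOn (Icc s s') b → (∀ τ ∈ Icc s s', VectorCalculus.IsDivFree (b τ)) →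
      (∀ τ ∈ Icc s s', ∀ x, ‖b τ x‖ ≤ B) → ContDiffOn ℝ 2 (uncurry W) (Icc s s' ×ˢ univ) →
      (∀ τ ∈ Icc s s', ∀ x, timeDerivWithin (Icc s s') W τ x + fderiv ℝ (W τ) x (b τ x) +
        ν * Laplacian.laplacian (W τ) x = 0) →
      (∀ τ ∈ Icc s s', ∀ x, |W τ x| ≤ A * Real.exp (-‖x‖ ^ 2 / a)) →
      ∫ x, |W s x| ≤ ∫ x, |W s' x|)
    (hBlock : ∀ (ν B s₀ s s' s₁ : ℝ)
      (b : ℝ → EuclideanSpace ℝ (Fin 3) → EuclideanSpace ℝ (Fin 3))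
      (f : EuclideanSpace ℝ (Fin 3) → ℝ), 0 < ν → 0 ≤ B → s₀ < s → s < s' → s' < s₁ →
      IsSmoothSpaceTimeOn (Icc s₀ s₁) b → (∀ τ ∈ Icc s₀ s₁, VectorCalculus.IsDivFree (b τ)) →
      (∀ τ ∈ Icc s₀ s₁, ∀ x, ‖b τ x‖ ≤ B) → ContDiff ℝ (⊤ : ℕ∞) f → HasCompactSupport f →
      (∀ x, 0 ≤ f x) → ∃ W : ℝ → EuclideanSpace ℝ (Fin 3) → ℝ,
        ContDiffOn ℝ 2 (uncurry W) (Ico s s' ×ˢ univ) ∧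
        (∀ τ ∈ Ico s s', ∀ x, timeDerivWithin (Ico s s') W τ x + fderiv ℝ (W τ) x (b τ x) +
          ν * Laplacian.laplacian (W τ) x = 0) ∧
        (∀ τ ∈ Ico s s', ∀ x, 0 ≤ W τ x) ∧
        (∃ A a : ℝ, 0 < a ∧ ∀ τ ∈ Ico s s', ∀ x, W τ x ≤ A * Real.exp (-‖x‖ ^ 2 / a)) ∧
        (∀ ε : ℝ, 0 < ε → ∃ s₂ ∈ Ico s s', ∀ τ ∈ Ico s₂ s', ∀ x, |W τ x - f x| ≤ ε))
    {ν C T : ℝ} {S : Set ℝ} {b : ℝ → EuclideanSpace ℝ (Fin 3) → EuclideanSpace ℝ (Fin 3)}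
    {x₀ : EuclideanSpace ℝ (Fin 3)} (hν : 0 < ν) (hST : S ⊆ Iio T) (hb : IsSmoothSpaceTimeOn S b)
    (hdiv : ∀ t ∈ S, VectorCalculus.IsDivFree (b t))
    (hbd : ∀ t ∈ S, ∀ x, ‖b t x‖ ≤ C / Real.sqrt (T - t)) {R : ℝ} (hR : 0 < R) {s₀ σ σ' : ℝ}
    (hs₀ : s₀ < σ) (hσσ' : σ < σ') (hσ'T : σ' < T) (hℓ : T - σ = 2 * (T - σ'))
    (hI : Icc s₀ (σ' + (T - σ') / 2) ⊆ S) {f : EuclideanSpace ℝ (Fin 3) → ℝ}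
    (hf : ContDiff ℝ (⊤ : ℕ∞) f) (hfs : HasCompactSupport f) (hf0 : ∀ x, 0 ≤ f x) :
    ∃ W : ℝ → EuclideanSpace ℝ (Fin 3) → ℝ,
      ContDiffOn ℝ 2 (uncurry W) (Ico σ σ' ×ˢ univ) ∧
      (∀ τ ∈ Ico σ σ', ∀ x, timeDerivWithin (Ico σ σ') W τ x + fderiv ℝ (W τ) x (b τ x) +
        ν * (Δ (W τ)) x = 0) ∧
      (∀ τ ∈ Ico σ σ', ∀ x, 0 ≤ W τ x) ∧
      (∃ A a : ℝ, 0 < a ∧ ∀ τ ∈ Ico σ σ', ∀ x, |W τ x| ≤ A * Real.exp (-‖x‖ ^ 2 / a)) ∧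
      (∀ x, Tendsto (fun τ => W τ x) (𝓝[<] σ') (𝓝 (f x))) ∧
      Integrable (W σ) ∧ (∫ x, W σ x ≤ ∫ x, f x) ∧
      ∀ x ∈ closedBall x₀ (R * Real.sqrt (T - σ')),
        (∫ z in closedBall x₀ (R * Real.sqrt (T - σ')), f z) *
          (kSubLow 3 (C / ν) (3 * R) ν * (T - σ') ^ (-(3:ℝ) / 2)) ≤ W σ x := by
  have hℓ0 : 0 < T - σ' := sub_pos.2 hσ'T
  have hσ's₁ : σ' < σ' + (T - σ') / 2 := by linarith
  have hs₁T : σ' + (T - σ') / 2 < T := by linarith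
  have h1 : s₀ < (s₀ + σ) / 2 := by linarith
  have h2 : (s₀ + σ) / 2 < σ := by linarith
  have hC : 0 ≤ C :=
    doeblin_C_nonneg (hST (hI ⟨hs₀.le, hσσ'.le.trans hσ's₁.le⟩)) (hbd σ (hI ⟨hs₀.le,
      hσσ'.le.trans hσ's₁.le⟩))
  have hBblk := doeblin_drift_bound hST hbd hI (by linarith)
  have hB0 : 0 ≤ C / Real.sqrt (T - (σ' + (T - σ') / 2)) := div_nonneg hC (Real.sqrt_nonneg _)
  obtain ⟨W, hWc, hWe, hW0, ⟨A, a, ha, hWA⟩, hatt⟩ := hBlock ν _ s₀ ((s₀ + σ) / 2) σ'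
    (σ' + (T - σ') / 2) b f hν hB0 h1 (h2.trans hσσ') hσ's₁ (hb.mono hI)
    (fun τ hτ => hdiv τ (hI hτ)) hBblk hf hfs hf0
  have hsub : Ico σ σ' ⊆ Ico ((s₀ + σ) / 2) σ' := Ico_subset_Ico h2.le le_rfl
  have hSI : Ico σ σ' ⊆ S := fun τ hτ =>
    hI ⟨(h1.trans h2).le.trans hτ.1, hτ.2.le.trans hσ's₁.le⟩
  have hr := doeblin_adj_mono hsub (uniqueDiffOn_Ico σ σ') hWc hWe
  have hAe : ∀ τ ∈ Ico σ σ', ∀ x, |W τ x| ≤ A * Real.exp (-‖x‖ ^ 2 / a) := fun τ hτ x => by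
    rw [abs_of_nonneg (hW0 τ (hsub hτ) x)]; exact hWA τ (hsub hτ) x
  have henv : ∃ A a : ℝ, 0 < a ∧ ∀ τ ∈ Ico σ σ', ∀ x, |W τ x| ≤ A * Real.exp (-‖x‖ ^ 2 / a) :=
    ⟨A, a, ha, hAe⟩
  have hlim : ∀ x, Tendsto (fun τ => W τ x) (𝓝[<] σ') (𝓝 (f x)) :=
    doeblin_tendsto_of_attain hatt
  have hfc : Continuous f := hf.continuous
  have hfi : Integrable f := hfc.integrable_of_hasCompactSupport hfs
  -- Kato in the limit: the mass does not exceed that of the data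
  have hK := doeblin_kato_limit hKato hν hST hb hdiv hbd hσσ' hSI hr.1 hr.2 henv hlim
  have hσm : σ ∈ Ico σ σ' := ⟨le_rfl, hσσ'⟩
  have hWσc : Continuous (W σ) := (doeblin_contDiff_slice hr.1 hσm).continuous
  have hWσi : Integrable (W σ) := doeblin_integrable_of_envelope hWσc ha (hAe σ hσm)
  have hmass : ∫ x, W σ x ≤ ∫ x, f x := by
    have e1 : ∫ x, W σ x = ∫ x, |W σ x| :=
      integral_congr_ae (ae_of_all _ fun x => (abs_of_nonneg (hW0 σ (hsub hσm) x)).symm)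
    have e2 : ∫ x, |f x| = ∫ x, f x :=
      integral_congr_ae (ae_of_all _ fun x => abs_of_nonneg (hf0 x))
    rw [e1, ← e2]; exact hK
  have hcore := doeblin_core_lower (x₀ := x₀) hν hST hb hbd h2 hσσ' hℓ hSI hσ'T hR hWc hWe hW0
    hatt hfc hfi
  exact ⟨W, hr.1, hr.2, fun τ hτ x => hW0 τ (hsub hτ) x, henv, hlim, hWσi, hmass, hcore⟩


/-! ### Registered sub-goal -/

/-- **Registered sub-goal `stub_doeblin_evolve`** (the explicit form of `doeblin_evolve`): what the
Doeblin step uses about the block solution evolving smooth compactly supported nonnegative data on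
a dyadic block — nonnegativity, Gaussian envelope, pointwise attainment, `∫ W(σ) ≤ ∫ f`, and the
block-independent lower bound on the core. -/
theorem stub_doeblin_evolve :
    (∀ (ν B s s' A a : ℝ) (b : ℝ → (EuclideanSpace ℝ (Fin 3)) → (EuclideanSpace ℝ (Fin 3))) (W : ℝ → (EuclideanSpace ℝ (Fin 3)) → ℝ), 0 < ν → s < s' → 0 < a → IsSmoothSpaceTimeOn (Icc s s') b → (∀ τ ∈ Icc s s', VectorCalculus.IsDivFree (b τ)) → (∀ τ ∈ Icc s s', ∀ x, ‖b τ x‖ ≤ B) → ContDiffOn ℝ 2 (uncurry W) (Icc s s' ×ˢ univ) → (∀ τ ∈ Icc s s', ∀ x, timeDerivWithin (Icc s s') W τ x + fderiv ℝ (W τ) x (b τ x) + ν * Laplacian.laplacian (W τ) x = 0) → (∀ τ ∈ Icc s s', ∀ x, |W τ x| ≤ A * Real.exp (-‖x‖ ^ 2 / a)) → ∫ x, |W s x| ≤ ∫ x, |W s' x|) → (∀ (ν B s₀ s s' s₁ : ℝ) (b : ℝ → (EuclideanSpace ℝ (Fin 3)) → (EuclideanSpace ℝ (Fin 3))) (f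 : (EuclideanSpace ℝ (Fin 3)) → ℝ), 0 < ν → 0 ≤ B → s₀ < s → s < s' → s' < s₁ → IsSmoothSpaceTimeOn (Icc s₀ s₁) b → (∀ τ ∈ Icc s₀ s₁, VectorCalculus.IsDivFree (b τ)) → (∀ τ ∈ Icc s₀ s₁, ∀ x, ‖b τ x‖ ≤ B) → ContDiff ℝ (⊤ : ℕ∞) f → HasCompactSupport f → (∀ x, 0 ≤ f x) → ∃ W : ℝ → (EuclideanSpace ℝ (Fin 3)) → ℝ, ContDiffOn ℝ 2 (uncurry W) (Ico s s' ×ˢ univ) ∧ (∀ τ ∈ Ico s s', ∀ x, timeDerivWithin (Ico s s') W τ x + fderiv ℝ (W τ) x (b τ x) + ν * Laplacian.laplacian (W τ) x = 0) ∧ (∀ τ ∈ Ico s s', ∀ x, 0 ≤ W τ x) ∧ (∃ A a : ℝ, 0 < a ∧ ∀ τ ∈ Ico s s', ∀ x, W τ x ≤ A * Real.exp (-‖x‖ ^ 2 / a)) ∧ (∀ ε : ℝ, 0 < ε → ∃ s₂ ∈ Ico s s', ∀ τ ∈ Ico s₂ s', ∀ x, |W τ x - f x| ≤ ε)) → ∀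 (ν C T : ℝ) (S : Set ℝ) (b : ℝ → (EuclideanSpace ℝ (Fin 3)) → (EuclideanSpace ℝ (Fin 3))) (x₀ : (EuclideanSpace ℝ (Fin 3))) (R s₀ σ σ' : ℝ) (f : (EuclideanSpace ℝ (Fin 3)) → ℝ), 0 < ν → S ⊆ Iio T → IsSmoothSpaceTimeOn S b → (∀ t ∈ S, VectorCalculus.IsDivFree (b t)) → (∀ t ∈ S, ∀ x, ‖b t x‖ ≤ C / Real.sqrt (T - t)) → 0 < R → s₀ < σ → σ < σ' → σ' < T → T - σ = 2 * (T - σ') → Icc s₀ (σ' + (T - σ') / 2) ⊆ S → ContDiff ℝ (⊤ : ℕ∞) f → HasCompactSupport f → (∀ x, 0 ≤ f x) → ∃ W : ℝ → (EuclideanSpace ℝ (Fin 3)) → ℝ, ContDiffOn ℝ 2 (uncurry W) (Ico σ σ' ×ˢ univ) ∧ (∀ τ ∈ Ico σ σ', ∀ x, timeDerivWithin (Ico σ σ') W τ x + fderiv ℝ (W τ) x (b τ x) + ν * Laplacian.laplacian (W τ) x = 0) ∧ (∀ τ ∈ Ico σ σ', ∀ x, 0 ≤ W τ x) ∧ (∃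 A a : ℝ, 0 < a ∧ ∀ τ ∈ Ico σ σ', ∀ x, |W τ x| ≤ A * Real.exp (-‖x‖ ^ 2 / a)) ∧ (∀ x, Filter.Tendsto (fun τ => W τ x) (nhdsWithin σ' (Set.Iio σ')) (nhds (f x))) ∧ MeasureTheory.Integrable (W σ) ∧ (∫ x, W σ x ≤ ∫ x, f x) ∧ ∀ x ∈ Metric.closedBall x₀ (R * Real.sqrt (T - σ')), (∫ z in Metric.closedBall x₀ (R * Real.sqrt (T - σ')), f z) * (kSubLow 3 (C / ν) (3 * R) ν * (T - σ') ^ (-(3:ℝ) / 2)) ≤ W σ x :=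
  fun hKato hBlock _ _ _ _ _ _ _ _ _ _ _ hν hST hb hdiv hbd hR hs₀ hσσ' hσ'T hℓ hI hf hfs hf0 =>
    doeblin_evolve hKato hBlock hν hST hb hdiv hbd hR hs₀ hσσ' hσ'T hℓ hI hf hfs hf0

end Summit.NavierStokesRegularity.NavierStokesRegularity.Theorems.AdaptedFrequencyConverges.CloudFrameEffectiveTsai

end
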